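import Summits.QuantumFields.YangMills.Theorems.FluctuationComparisonRegPrIntLS2BetaTubularChartDockLocal
import HarnessLib

/-!
# LINE g18-1 S2β LAPLACE — (T2-SHIFT) OFF-PIVOT QUADRATIC TRANSVERSALITY OF THE TUBE AT EVERY BASE POINT OF THE WINDOW
# (the chart-side half of DET-REP-A's displayed path row «transversal GROWTH at `y s`», hypothesis form over the local edition's exported rows)

Crux `stmt-QuantumFields-20520` (`…Theses.UnitScaleTilt.FluctuationComparisonRegPrIntL`); cell `ym3-torus` (HUMAN RULING D-0037 — YM₃ on T³ is ladder rung
R3, not the Clay problem), width seat `ym3-torus-px21` g11; count-neutral helper (`--kind proof --supports stmt-QuantumFields-20520 --as helper`).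
Theorems only: 0 `def`, 0 `instance`, 0 `notation`, 0 `sorry`.

WHY.  The v11 DET-REP-A edge supplier (w5-20520 g14, worded by the LINE OWNER 22:08:47Z) displays, at every point `y₁ = y s` of the path of minimiser
coordinates in ONE corner tube, the transversal GROWTH row `c₁‖v‖² ≤ A(c.Φ(x s, σ(y₁ + v))) − A(c.Φ(x s, σ y₁))`; its discharge is GAP♯ ∘ (T2) ∘ «local carrier»
(px11 g10's ✓`…S2BetaFibreGrowth.growth_of_offPivot_orbitDist_le`), and (T2) is in the tree AT BASE `0` ONLY (✓p741985 ∕ ✓p745754 ∕ ✓p747125: the family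
`v ↦ σ v` leaves the orbit of `U₀ = σ 0` quadratically).  THIS FILE proves (T2) AT A SHIFTED BASE: the family `v ↦ σ (y₁ + v)` leaves the residual orbit of
`σ y₁` quadratically in the off-pivot `dist1²`-distance, for every `y₁` whose frame coordinates are small (`‖(eV y₁)_b‖ ≤ 1∕2` on every free bond — the
consumer has `y₁` near `0`), in HYPOTHESIS FORM over the rows (D0), (D1), (F4a) that the local edition ✓`…TubularChartDockLocal.exists_tubularHaarChart_pivotAct_local`
exports, so that it docks INSIDE the consumer's `obtain` (no new edition of the chart).
* §0 ★ `exists_norm_sub_le_norm_exp_neg_mul_exp_sub_one` — generic Banach algebra: for `‖X‖ ≤ 1∕2`, `c·‖Y − X‖ ≤ ‖e^{−X} e^{Y} − 1‖` for `Y` near `X`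
  (`Y ↦ e^{−X}e^{Y}` has derivative `g(ad X)` at `X`, lit ✓`hasFDerivAt_exp_neg_mul_exp`, INVERTIBLE by ✓`isUnit_gSer` since `‖ad X‖ ≤ 2‖X‖ ≤ 1`, ✓`norm_ad_le`)
  — the base-`X` twin of px21 g10's base-`0` letter ✓`exists_sq_norm_le_sum_norm_exp_sub_one_sq` (`g(0) = 1`);
* §1 ★ `exists_sq_norm_le_sum_norm_exp_neg_mul_exp_sub_one_sq` — the framed square-sum form through a Euclidean frame `eV : V ≃ 𝔤^B` at a base point `y₁`;
* §2 ★★ `offPivot_transversal_shift` — the lattice∕dock statement: from (D0)(D1)(F4a) and `‖(eV y₁)_b‖ ≤ 1∕2`,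
  `∃ c₁ > 0, ∀ᶠ v in 𝓝 0, c₁‖v‖² ≤ ⨅_{w residual} Σ_{ℓ ∉ pivots} dist1 (σ (y₁ + v) ℓ · ((w • σ y₁) ℓ)⁻¹)²`
  (✓`offPivot_transversal_of_rows` for the family `v ↦ σ(y₁+v)` at the base `σ y₁`: (A0)(A1) from (D0)(D1); (A2-shift) from §1, since by (F4a)
  `σ(y₁+v) b · (σ y₁ b)⁻¹` is a conjugate of `Θ(Y_b)·Θ(X_b)⁻¹` and `dist1` is a class function).
HONEST: a chart-side letter (inverse-function estimate for `exp` at a small base point + lattice bookkeeping); proves no stub; GROWTH's other half (GAP♯), DET-REP-A∕B,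
LAPLACE, S2β, crux 20520 NOT proved; rung R3 = YM₃ on T³ — NOT d = 4, NOT infinite volume, NOT a mass gap, NOT Clay.
[cite: Helgason2000, Ch. I §1 Thm 1.14 (12)-(13) p.96; Balaban1985Averaging, (33)-(34) pp.22-23; Balaban1985Variational, Thm 1 (10) p.279, (19) p.281; Hall2015, Thm 5.4]
-/

noncomputable section

open MeasureTheory MeasureTheory.Measure Filter Topology Set Function NormedSpace
open scoped ENNReal Matrix.Norms.L2Operator Nat
open Literature.MathematicalPhysics.QuantumFieldTheory.Balaban1983to89
open Literature.MathematicalPhysics.QuantumFieldTheory.Balaban1983to89.HaarExponentialChart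
open Literature.MathematicalPhysics.QuantumFieldTheory.Balaban1983to89.LogChartProduct
open Literature.MathematicalPhysics.QuantumFieldTheory.Balaban1983to89.T3ContinuumYM3Torus
open Literature.MathematicalPhysics.QuantumFieldTheory.Balaban1983to89.T3TiltDescent
open Literature.MathematicalPhysics.QuantumFieldTheory.Balaban1983to89.T3UnitLawDensityEML
open scoped Literature.MathematicalPhysics.QuantumFieldTheory.Balaban1983to89.T3OrbitAverage
open Literature.MathematicalPhysics.QuantumFieldTheory.Balaban1983to89.B13HaarSigmaJacobian (hasFDerivAt_exp_neg_mul_exp)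
open Literature.Analysis.Calculus.ExpDifferential
open Summit.QuantumFields.YangMills.Theorems.FluctuationComparisonRegPrIntLWregChain (iterCentralBond)
open Summit.QuantumFields.YangMills.Theorems.FluctuationComparisonRegPrIntLS2BetaSignedComb (combTransporter)
open Summit.QuantumFields.YangMills.Theorems.FluctuationComparisonRegPrIntLS2BetaSignedCombKill (combSet)
open Summit.QuantumFields.YangMills.Theorems.FluctuationComparisonRegPrIntLS2BetaTubularChartDockTransversal (offPivot_transversal_of_rows)

namespace Summit.QuantumFields.YangMills.Theorems.FluctuationComparisonRegPrIntLS2BetaTransversalShift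

/-! ## §0  `Y ↦ e^{−X} e^{Y}` leaves `1` at a linear rate near a SMALL base point `X` -/

section ExpBase

variable {𝔸 : Type*} [NormedRing 𝔸] [CompleteSpace 𝔸]

/-- ★ **`‖e^{−X}e^{Y} − 1‖ ≥ c·‖Y − X‖` FOR `Y` NEAR A SMALL BASE POINT `X`** (`‖X‖ ≤ 1∕2`): the map `Y ↦ e^{−X}e^{Y}` has Fréchet derivative `g(ad X)`
at `Y = X` (lit ✓`hasFDerivAt_exp_neg_mul_exp`), and `g(ad X)` is invertible in the Banach algebra of operators because `‖ad X‖ ≤ 2‖X‖ ≤ 1`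
(lit ✓`norm_ad_le`, ✓`isUnit_gSer`); `c = 1∕(2(‖g(ad X)⁻¹‖ + 1))`. [cite: Balaban1985Averaging, (33)-(34) pp.22-23; Hall2015, Thm 5.4] -/
theorem exists_norm_sub_le_norm_exp_neg_mul_exp_sub_one (𝕂 : Type*) [RCLike 𝕂] [NormedAlgebra 𝕂 𝔸] {X : 𝔸} (hX : ‖X‖ ≤ 1 / 2) :
    ∃ c : ℝ, 0 < c ∧ ∀ᶠ Y in 𝓝 X, c * ‖Y - X‖ ≤ ‖exp (-X) * exp Y - 1‖ := by
  have hL1 : ‖ad 𝕂 X‖ ≤ 1 := (norm_ad_le (𝕂 := 𝕂) X).trans (by linarith)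
  obtain ⟨u, hu⟩ := isUnit_gSer (𝕂 := 𝕂) hL1
  set G : 𝔸 →L[𝕂] 𝔸 := ((u⁻¹ : (𝔸 →L[𝕂] 𝔸)ˣ) : 𝔸 →L[𝕂] 𝔸) with hG
  -- `G ∘ g(ad X) = 1`
  have hGL : ∀ V, G (gSer 𝕂 (ad 𝕂 X) V) = V := by
    intro V
    have h1 : ((u⁻¹ : (𝔸 →L[𝕂] 𝔸)ˣ) : 𝔸 →L[𝕂] 𝔸) * (u : 𝔸 →L[𝕂] 𝔸) = 1 := Units.inv_mul u
    have h2 := congrArg (fun T : 𝔸 →L[𝕂] 𝔸 => T V) h1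
    simpa only [hG, hu, mul_apply_eq_comp, one_apply_eq_self] using h2
  have hlow : ∀ V, ‖V‖ ≤ (‖G‖ + 1) * ‖gSer 𝕂 (ad 𝕂 X) V‖ := by
    intro V
    calc ‖V‖ = ‖G (gSer 𝕂 (ad 𝕂 X) V)‖ := by rw [hGL]
      _ ≤ ‖G‖ * ‖gSer 𝕂 (ad 𝕂 X) V‖ := G.le_opNorm _
      _ ≤ (‖G‖ + 1) * ‖gSer 𝕂 (ad 𝕂 X) V‖ := by gcongr; linarith
  have ha : 0 < ‖G‖ + 1 := by positivity
  have hε : (0 : ℝ) < 1 / (2 * (‖G‖ + 1)) := by positivity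
  have hev := (hasFDerivAt_exp_neg_mul_exp (𝕂 := 𝕂) X).isLittleO.def hε
  refine ⟨1 / (2 * (‖G‖ + 1)), hε, ?_⟩
  filter_upwards [hev] with Y hY
  rw [exp_neg_mul_exp_eq_one (𝕂 := 𝕂) X] at hY
  -- `‖g(ad X)(Y − X)‖ ≤ ‖e^{−X}e^{Y} − 1‖ + ‖e^{−X}e^{Y} − 1 − g(ad X)(Y − X)‖`
  have h1 : ‖gSer 𝕂 (ad 𝕂 X) (Y - X)‖ ≤ ‖exp (-X) * exp Y - 1‖ + ‖exp (-X) * exp Y - 1 - gSer 𝕂 (ad 𝕂 X) (Y - X)‖ := by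
    calc ‖gSer 𝕂 (ad 𝕂 X) (Y - X)‖
        = ‖(exp (-X) * exp Y - 1) - (exp (-X) * exp Y - 1 - gSer 𝕂 (ad 𝕂 X) (Y - X))‖ := by congr 1; abel
      _ ≤ ‖exp (-X) * exp Y - 1‖ + ‖exp (-X) * exp Y - 1 - gSer 𝕂 (ad 𝕂 X) (Y - X)‖ := norm_sub_le _ _
  have h2 := hlow (Y - X)
  have h3 : ‖Y - X‖ / (‖G‖ + 1) ≤ ‖gSer 𝕂 (ad 𝕂 X) (Y - X)‖ := by
    rw [div_le_iff₀ ha]; linarith [h2]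
  have h4 : (1 / (2 * (‖G‖ + 1))) * ‖Y - X‖ = ‖Y - X‖ / (‖G‖ + 1) - (1 / (2 * (‖G‖ + 1))) * ‖Y - X‖ := by
    field_simp; ring
  linarith [h1, hY, h3, h4]

end ExpBase

/-! ## §1  The framed square-sum form at a base point -/

section Frame

variable {𝔸 : Type*} [NormedRing 𝔸] [NormedAlgebra ℂ 𝔸] [CompleteSpace 𝔸]
variable (C : LogChart 𝔸) {B : Type*} [Fintype B]
variable {V : Type*} [NormedAddCommGroup V] [NormedSpace ℝ V]

/-- ★ **THE FREE-BOND EXPONENTIAL COORDINATES LEAVE A SMALL BASE POINT AT A LINEAR RATE, IN SQUARE SUM OVER THE COMPONENTS**: for a Euclidean frame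
`eV : V ≃ 𝔤^B` and a base point `y₁` with `‖(eV y₁)_b‖ ≤ 1∕2` for every `b`, there is `c > 0` with
`c‖v‖² ≤ Σ_b ‖exp(−(eV y₁)_b) · exp((eV (y₁ + v))_b) − 1‖²` for `v` near `0` (§0 componentwise with a common constant `c₀ = 1∕(Σ_b c_b⁻¹ + 1)`, the sup norm of
`𝔤^B ⊂ 𝔸^B` dominated by the `ℓ²`-sum of the components, and `‖v‖ ≤ ‖eV⁻¹‖·‖eV v‖` — exactly the bookkeeping of ✓`exists_sq_norm_le_sum_norm_exp_sub_one_sq`).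
[cite: Helgason2000, Ch. I §1 Thm 1.14 (13) p.96; Balaban1985Averaging, (33)-(34) pp.22-23] -/
theorem exists_sq_norm_le_sum_norm_exp_neg_mul_exp_sub_one_sq (eV : V ≃L[ℝ] (piLogChart C B).lie) (y₁ : V)
    (hy₁ : ∀ b : B, ‖((eV y₁ : (piLogChart C B).lie) : B → 𝔸) b‖ ≤ 1 / 2) :
    ∃ c : ℝ, 0 < c ∧ ∀ᶠ v in 𝓝 (0 : V),
      c * ‖v‖ ^ 2 ≤ ∑ b : B, ‖exp (-(((eV y₁ : (piLogChart C B).lie) : B → 𝔸) b)) *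
        exp (((eV (y₁ + v) : (piLogChart C B).lie) : B → 𝔸) b) - 1‖ ^ 2 := by
  -- componentwise constants from §0
  choose c hc hev using fun b : B => exists_norm_sub_le_norm_exp_neg_mul_exp_sub_one ℝ (hy₁ b)
  -- transport to `v` through the continuous affine components `v ↦ (eV (y₁ + v))_b`, all `b` at once (`B` finite)
  have hall : ∀ᶠ v in 𝓝 (0 : V), ∀ b : B,
      c b * ‖((eV v : (piLogChart C B).lie) : B → 𝔸) b‖ ≤ ‖exp (-(((eV y₁ : (piLogChart C B).lie) : B → 𝔸) b)) *
        exp (((eV (y₁ + v) : (piLogChart C B).lie) : B → 𝔸) b) - 1‖ := by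
    refine Filter.eventually_all.2 fun b => ?_
    have hcont : Continuous fun v : V => ((eV (y₁ + v) : (piLogChart C B).lie) : B → 𝔸) b :=
      (continuous_apply b).comp (continuous_subtype_val.comp (eV.continuous.comp (continuous_const.add continuous_id)))
    have ht : Tendsto (fun v : V => ((eV (y₁ + v) : (piLogChart C B).lie) : B → 𝔸) b) (𝓝 0)
        (𝓝 (((eV y₁ : (piLogChart C B).lie) : B → 𝔸) b)) := by
      simpa using hcont.tendsto (0 : V)
    filter_upwards [ht.eventually (hev b)] with v hv
    have hdiff : ((eV (y₁ + v) : (piLogChart C B).lie) : B → 𝔸) b - ((eV y₁ : (piLogChart C B).lie) : B → 𝔸) b =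
        ((eV v : (piLogChart C B).lie) : B → 𝔸) b := by
      rw [map_add, Submodule.coe_add, Pi.add_apply]; abel
    rwa [hdiff] at hv
  -- a common constant `c₀ ≤ c b`
  set D : ℝ := ∑ b : B, (c b)⁻¹ + 1 with hD
  have hD0 : 0 < D := by
    have : 0 ≤ ∑ b : B, (c b)⁻¹ := Finset.sum_nonneg fun b _ => (inv_pos.2 (hc b)).le
    linarith
  have hc₀ : ∀ b, 1 / D ≤ c b := by
    intro b
    have h1 : (c b)⁻¹ ≤ D := by
      have := Finset.single_le_sum (f := fun b => (c b)⁻¹) (fun b _ => (inv_pos.2 (hc b)).le) (Finset.mem_univ b)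
      linarith
    rw [one_div]
    calc D⁻¹ ≤ ((c b)⁻¹)⁻¹ := inv_anti₀ (inv_pos.2 (hc b)) h1
      _ = c b := inv_inv _
  set K : ℝ := ‖(eV.symm : (piLogChart C B).lie →L[ℝ] V)‖ with hK
  have hK0 : 0 ≤ K := norm_nonneg (eV.symm : (piLogChart C B).lie →L[ℝ] V)
  refine ⟨(1 / D) ^ 2 / (K ^ 2 + 1), by positivity, ?_⟩
  filter_upwards [hall] with v hv
  -- `‖v‖ ≤ K‖eV v‖`
  have hv1 : ‖v‖ ≤ K * ‖(eV v : (piLogChart C B).lie)‖ := by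
    have h := (eV.symm : (piLogChart C B).lie →L[ℝ] V).le_opNorm (eV v)
    simpa [hK] using h
  -- `‖eV v‖² ≤ Σ_b ‖(eV v)_b‖²`
  set Xv : B → 𝔸 := ((eV v : (piLogChart C B).lie) : B → 𝔸) with hXv
  have hX2 : ‖(eV v : (piLogChart C B).lie)‖ ^ 2 ≤ ∑ b : B, ‖Xv b‖ ^ 2 := by
    have hn : ‖(eV v : (piLogChart C B).lie)‖ = ‖Xv‖ := rfl
    rw [hn]
    have hsum0 : 0 ≤ ∑ b : B, ‖Xv b‖ ^ 2 := Finset.sum_nonneg fun b _ => sq_nonneg _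
    have hle : ‖Xv‖ ≤ Real.sqrt (∑ b : B, ‖Xv b‖ ^ 2) := by
      refine (pi_norm_le_iff_of_nonneg (Real.sqrt_nonneg _)).2 fun b => ?_
      refine (Real.le_sqrt (norm_nonneg _) hsum0).2 ?_
      exact Finset.single_le_sum (f := fun b => ‖Xv b‖ ^ 2) (fun b _ => sq_nonneg _) (Finset.mem_univ b)
    calc ‖Xv‖ ^ 2 ≤ (Real.sqrt (∑ b : B, ‖Xv b‖ ^ 2)) ^ 2 := pow_le_pow_left₀ (norm_nonneg _) hle 2
      _ = ∑ b : B, ‖Xv b‖ ^ 2 := Real.sq_sqrt hsum0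
  -- `(1/D)² Σ_b ‖(eV v)_b‖² ≤ Σ_b ‖e^{−X_b}e^{Y_b} − 1‖²`
  set S := ∑ b : B, ‖exp (-(((eV y₁ : (piLogChart C B).lie) : B → 𝔸) b)) *
    exp (((eV (y₁ + v) : (piLogChart C B).lie) : B → 𝔸) b) - 1‖ ^ 2 with hS
  have hS0 : 0 ≤ S := Finset.sum_nonneg fun b _ => sq_nonneg _
  have hX3 : (1 / D) ^ 2 * ∑ b : B, ‖Xv b‖ ^ 2 ≤ S := by
    rw [hS, Finset.mul_sum]
    refine Finset.sum_le_sum fun b _ => ?_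
    have hb := hv b
    have h0 : 0 ≤ (1 / D) * ‖Xv b‖ := by positivity
    have h1 : (1 / D) * ‖Xv b‖ ≤ c b * ‖Xv b‖ := mul_le_mul_of_nonneg_right (hc₀ b) (norm_nonneg _)
    calc (1 / D) ^ 2 * ‖Xv b‖ ^ 2 = ((1 / D) * ‖Xv b‖) ^ 2 := by ring
      _ ≤ _ := pow_le_pow_left₀ h0 (h1.trans hb) 2
  have hv2 : ‖v‖ ^ 2 ≤ K ^ 2 * ∑ b : B, ‖Xv b‖ ^ 2 := by
    calc ‖v‖ ^ 2 ≤ (K * ‖(eV v : (piLogChart C B).lie)‖) ^ 2 := pow_le_pow_left₀ (norm_nonneg _) hv1 2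
      _ = K ^ 2 * ‖(eV v : (piLogChart C B).lie)‖ ^ 2 := by ring
      _ ≤ K ^ 2 * ∑ b : B, ‖Xv b‖ ^ 2 := by gcongr
  have hsum0 : 0 ≤ ∑ b : B, ‖Xv b‖ ^ 2 := Finset.sum_nonneg fun b _ => sq_nonneg _
  rw [div_mul_eq_mul_div, div_le_iff₀ (by positivity)]
  nlinarith [hX3, hv2, hsum0, hS0, sq_nonneg K, sq_nonneg (1 / D)]

end Frame

/-! ## §2  (T2-SHIFT) on the lattice: the tube leaves the residual orbit of `σ y₁` quadratically, off the pivots -/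

variable (F : T3Family) {J K : ℕ} (hJK : J ≤ K)

/-- ★★ **(T2-SHIFT) OFF-PIVOT QUADRATIC TRANSVERSALITY OF THE TUBE AT A SHIFTED BASE POINT**, hypothesis form over the rows of the local edition
✓`…TubularChartDockLocal.exists_tubularHaarChart_pivotAct_local` ((D0) `σ = U₀` on comb ∪ pivots, (D1) constant comb transporter, (F4a) the bondwise formula with
the frame `eV`): for every base point `y₁` whose free-bond coordinates are small (`‖(eV y₁)_b‖ ≤ 1∕2`; the consumer's `y₁ = y s` is near `0`), the family
`v ↦ σ (y₁ + v)` leaves the RESIDUAL ORBIT of `σ y₁` quadratically in the off-pivot `dist1²`-distance: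
`∃ c₁ > 0, ∀ᶠ v in 𝓝 0, c₁‖v‖² ≤ ⨅_{w residual} Σ_{ℓ ∉ pivots} dist1 (σ (y₁ + v) ℓ · ((w • σ y₁) ℓ)⁻¹)²` — the binder `ht` of px11's
✓`growth_of_offPivot_orbitDist_le` at the base `σ y₁`.  Proof: ✓`offPivot_transversal_of_rows` for that family; (A2-shift) from §1 because by (F4a)
`σ(y₁+v) b · (σ y₁ b)⁻¹` is a conjugate of `Θ(Y_b)·Θ(X_b)⁻¹`, `dist1` is a class function and `dist1(Θ(X)⁻¹Θ(Y)) = ‖e^{−X}e^{Y} − 1‖`.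
[cite: Balaban1985Variational, Thm 1 (10) p.279, (19) p.281; Helgason2000, Ch. I §1 Thm 1.14 (13) p.96] -/
theorem offPivot_transversal_shift (hk : K - J ≤ (F.P K).m + (F.P K).K)
    [DecidablePred (· ∈ (combSet (K - J) : Set (PBond (F.P K) 0)) ∪ Set.range (iterCentralBond (P := F.P K) (K - J)))] {dV : ℕ}
    {σ : EuclideanSpace ℝ (Fin dV) → GaugeField (F.P K) 0 (Matrix.specialUnitaryGroup (Fin 2) ℂ)}
    {U₀ : GaugeField (F.P K) 0 (Matrix.specialUnitaryGroup (Fin 2) ℂ)}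
    (eV : EuclideanSpace ℝ (Fin dV) ≃L[ℝ] (piLogChart (specialUnitaryLogChart (Fin 2))
      {b : PBond (F.P K) 0 // b ∉ (combSet (K - J) : Set (PBond (F.P K) 0)) ∪ Set.range (iterCentralBond (P := F.P K) (K - J))}).lie)
    (hD0 : ∀ y, ∀ b ∈ (combSet (K - J) : Set (PBond (F.P K) 0)) ∪ Set.range (iterCentralBond (P := F.P K) (K - J)), σ y b = U₀ b)
    (hD1 : ∀ y, combTransporter (K - J) (σ y) = combTransporter (K - J) U₀)
    (hF4a : ∀ y (b : PBond (F.P K) 0) (hb : b ∉ (combSet (K - J) : Set (PBond (F.P K) 0)) ∪ Set.range (iterCentralBond (P := F.P K) (K - J))),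
      σ y b = U₀ b * ((combTransporter (K - J) U₀ b.tgt)⁻¹ *
        (isChartRep_specialUnitaryGroup (n := Fin 2)).expChart
          (lieApply (specialUnitaryLogChart (Fin 2)) {b : PBond (F.P K) 0 // b ∉ (combSet (K - J) : Set (PBond (F.P K) 0)) ∪
            Set.range (iterCentralBond (P := F.P K) (K - J))} (eV y) ⟨b, hb⟩) *
        combTransporter (K - J) U₀ b.tgt))
    (y₁ : EuclideanSpace ℝ (Fin dV))
    (hy₁ : ∀ b : {b : PBond (F.P K) 0 // b ∉ (combSet (K - J) : Set (PBond (F.P K) 0)) ∪ Set.range (iterCentralBond (P := F.P K) (K - J))},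
      ‖((eV y₁ : (piLogChart (specialUnitaryLogChart (Fin 2)) _).lie) : _ → Matrix (Fin 2) (Fin 2) ℂ) b‖ ≤ 1 / 2) :
    ∃ c₁ : ℝ, 0 < c₁ ∧ ∀ᶠ v in 𝓝 (0 : EuclideanSpace ℝ (Fin dV)),
      c₁ * ‖v‖ ^ 2 ≤ ⨅ w : {w : Site (F.P K) 0 → Matrix.specialUnitaryGroup (Fin 2) ℂ |
            ∀ U : GaugeField (F.P K) 0 (Matrix.specialUnitaryGroup (Fin 2) ℂ),
              descendTo F ℰp J K hJK (GaugeField.gaugeAct w U) = descendTo F ℰp J K hJK U},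
          ∑ ℓ ∈ Finset.univ.filter (fun ℓ : PBond (F.P K) 0 => ∀ c, iterCentralBond (P := F.P K) (K - J) c ≠ ℓ),
            dist1 (σ (y₁ + v) ℓ * ((GaugeField.gaugeAct (w : Site (F.P K) 0 → Matrix.specialUnitaryGroup (Fin 2) ℂ) (σ y₁)) ℓ)⁻¹) ^ 2 := by
  -- the killed bonds (a `let`, NOT a `set`: the statement's `DecidablePred` binder must stay the one instance of record)
  let F' : Set (PBond (F.P K) 0) := (combSet (K - J) : Set (PBond (F.P K) 0)) ∪ Set.range (iterCentralBond (P := F.P K) (K - J))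
  letI : DecidablePred (· ∈ F') :=
    ‹DecidablePred (· ∈ (combSet (K - J) : Set (PBond (F.P K) 0)) ∪ Set.range (iterCentralBond (P := F.P K) (K - J)))›
  set hch := isChartRep_specialUnitaryGroup (n := Fin 2) with hhch
  refine offPivot_transversal_of_rows F hJK hk (σ := fun v => σ (y₁ + v)) (U₀ := σ y₁) ?_ ?_ ?_
  · -- (A0) for the shifted family at the base `σ y₁`: both sides are `U₀` on comb ∪ pivots
    intro v b hb
    rw [hD0 (y₁ + v) b hb, hD0 y₁ b hb]
  · -- (A1): the comb transporter is constant along `σ`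
    intro v
    rw [hD1 (y₁ + v), hD1 y₁]
  · -- (A2-shift): quadratic departure from `σ y₁`, from §1 through (F4a)
    obtain ⟨c, hc, hev⟩ := exists_sq_norm_le_sum_norm_exp_neg_mul_exp_sub_one_sq (specialUnitaryLogChart (Fin 2)) eV y₁ hy₁
    refine ⟨c, hc, ?_⟩
    filter_upwards [hev] with v hv
    refine hv.trans ?_
    -- the free-bond terms: `dist1 (σ(y₁+v) b · (σ y₁ b)⁻¹) = ‖e^{−X_b} e^{Y_b} − 1‖`
    have hterm : ∀ b : {b : PBond (F.P K) 0 // b ∉ F'},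
        ‖exp (-(((eV y₁ : (piLogChart (specialUnitaryLogChart (Fin 2)) {b : PBond (F.P K) 0 // b ∉ F'}).lie) :
            {b : PBond (F.P K) 0 // b ∉ F'} → Matrix (Fin 2) (Fin 2) ℂ) b)) *
          exp (((eV (y₁ + v) : (piLogChart (specialUnitaryLogChart (Fin 2)) {b : PBond (F.P K) 0 // b ∉ F'}).lie) :
            {b : PBond (F.P K) 0 // b ∉ F'} → Matrix (Fin 2) (Fin 2) ℂ) b) - 1‖ ^ 2 =
          dist1 (σ (y₁ + v) b * (σ y₁ b)⁻¹) ^ 2 := by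
      intro b
      have e1 := hF4a (y₁ + v) b.1 b.2
      have e0 := hF4a y₁ b.1 b.2
      simp only [Subtype.coe_eta] at e1 e0
      set X := lieApply (specialUnitaryLogChart (Fin 2)) {b : PBond (F.P K) 0 // b ∉ F'} (eV y₁) b with hX
      set Y := lieApply (specialUnitaryLogChart (Fin 2)) {b : PBond (F.P K) 0 // b ∉ F'} (eV (y₁ + v)) b with hY
      set T := combTransporter (K - J) U₀ b.1.tgt with hT
      have h1 : σ (y₁ + v) b * (σ y₁ b)⁻¹ = (U₀ b * T⁻¹) * (hch.expChart Y * (hch.expChart X)⁻¹) * (U₀ b * T⁻¹)⁻¹ := by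
        rw [e1, e0]
        group
      have h2 : dist1 (σ (y₁ + v) b * (σ y₁ b)⁻¹) = dist1 ((hch.expChart X)⁻¹ * hch.expChart Y) := by
        rw [h1, GaugeGroup.dist1_conj,
          show (hch.expChart X)⁻¹ * hch.expChart Y = (hch.expChart X)⁻¹ * (hch.expChart Y * (hch.expChart X)⁻¹) * (hch.expChart X)⁻¹⁻¹ by group,
          GaugeGroup.dist1_conj]
      rw [h2, ← hch.expChart_neg]
      show _ = ‖(Literature.MathematicalPhysics.QuantumLattice.fundamentalRep (Fin 2)) (hch.expChart (-X) * hch.expChart Y) - 1‖ ^ 2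
      rw [map_mul, hch.rho_expChart, hch.rho_expChart, Submodule.coe_neg, coe_lieApply, coe_lieApply]
    calc ∑ b : {b : PBond (F.P K) 0 // b ∉ F'},
          ‖exp (-(((eV y₁ : (piLogChart (specialUnitaryLogChart (Fin 2)) {b : PBond (F.P K) 0 // b ∉ F'}).lie) :
              {b : PBond (F.P K) 0 // b ∉ F'} → Matrix (Fin 2) (Fin 2) ℂ) b)) *
            exp (((eV (y₁ + v) : (piLogChart (specialUnitaryLogChart (Fin 2)) {b : PBond (F.P K) 0 // b ∉ F'}).lie) :
              {b : PBond (F.P K) 0 // b ∉ F'} → Matrix (Fin 2) (Fin 2) ℂ) b) - 1‖ ^ 2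
        = ∑ b : {b : PBond (F.P K) 0 // b ∉ F'}, dist1 (σ (y₁ + v) b * (σ y₁ b)⁻¹) ^ 2 := Finset.sum_congr rfl fun b _ => hterm b
      _ = ∑ b ∈ Finset.univ.filter (fun b : PBond (F.P K) 0 => b ∉ F'), dist1 (σ (y₁ + v) b * (σ y₁ b)⁻¹) ^ 2 :=
        (Finset.sum_subtype _ (fun b => by simp) (fun b : PBond (F.P K) 0 => dist1 (σ (y₁ + v) b * (σ y₁ b)⁻¹) ^ 2)).symm
      _ ≤ ∑ b : PBond (F.P K) 0, dist1 (σ (y₁ + v) b * (σ y₁ b)⁻¹) ^ 2 :=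
        Finset.sum_le_sum_of_subset_of_nonneg (Finset.filter_subset _ _) fun _ _ _ => sq_nonneg _

end Summit.QuantumFields.YangMills.Theorems.FluctuationComparisonRegPrIntLS2BetaTransversalShift

end
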